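import Summits.PneNP.PneNP.Theorems.PhaseTwinsMacroscopicTwinsAboveConnectorPattern

/-!
# Route PhaseTwins, crux `MacroscopicTwinsAbove` (stmt-PneNP-2720), line `literal-gadgets-cfi-apparatus`:
# the product-measure expectation of the pattern weight (support for `stub_connector`, part 3)

Sly's Lemma 2.2, last display, for the literal-gadget wiring. Under the product measures `Q^{Y_g}` on the ports of
the copies (occupation probability `q⁺` on `V⁺`, `q⁻` on `V⁻` in phase `+`, swapped in phase `−`: `occP`, `occM`), the
expectation of the weight `lgWt` of a pattern family is EXPLICIT:

  `Σ_P (Π_g Q^{Y_g}(P_g)) · lgWt(P) = lgW b Y · (1+λ)^{10mK}`     (`expect_lgWt`),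

because the pair indicators and the `m·K` complex factors read pairwise DISJOINT sets of port coordinates (the slot map
is injective and the occurrence colouring is injective on the occurrences of a variable, `coordMap_injective`), so the
expectation factorises (`sum_bw_marginal`, `sum_bw_prod_split` of the sibling toolkit `ConnectorFibres`) into the pair
factors `pairW` (`sum_bernoulliWeight_noPair`) and the complex factors `cxWeight` at the mean vacancies `1 - q`
(multilinearity, `sum_bw_cxWeight`). Elementary finite combinatorics. [folklore]
-/

noncomputable section

open scoped Classical BigOperators

namespace Summit.PneNP.PneNP.Cruxes.MacroscopicTwinsAbove.LiteralGadgetsCfiApparatus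

open Finset
open Literature.Computability.Complexity (portLaw SlyReduction.sum_bernoulliWeight SlyReduction.sum_bernoulliWeight_noPair)
open Literature.ModelTheory.FiniteModelTheory.CFIMatching (bit)
open Summit.PneNP.PneNP.Cruxes.PolyDepthTwinsAbove.ParityWiredPorts (occP occM pairW CxVert cxGraph cxWeight cxW
  sum_eq_sum_fib card_eq_sum_card_fib bw_eq_prod_fib bw_sum_split sum_bw_prod_split sum_bw_marginal sum_bw_disjoint)

-- `Summit.PneNP.PneNP.…` (summit = sub-problem name) trips the duplicate-namespace linter on every declaration.
set_option linter.dupNamespace false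

variable {nv m v P κ₁ D K : ℕ}

/-! ## Two small instance-agnostic tools -/

/-- Equivalent conditions give equal `if`-expressions, whatever the decidability instances. -/
theorem ite_congr_prop {α : Sort*} {A B : Prop} {iA : Decidable A} {iB : Decidable B} (h : A ↔ B) (a c : α) :
    @ite α A iA a c = @ite α B iB a c := by
  by_cases hA : A
  · rw [if_pos hA, if_pos (h.1 hA)]
  · rw [if_neg hA, if_neg (fun hB => hA (h.2 hB))]

/-- Over a sum of coordinate types, a PRODUCT integrand splits the Bernoulli sum into a product of two Bernoulli
sums (independence of the two coordinate blocks). -/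
theorem sum_bw_sum_mul {C₁ C₂ : Type*} [Fintype C₁] [Fintype C₂] [DecidableEq C₁] [DecidableEq C₂]
    (p : C₁ ⊕ C₂ → ℝ) (G₁ : Finset C₁ → ℝ) (G₂ : Finset C₂ → ℝ) :
    ∑ t : Finset (C₁ ⊕ C₂), ((∏ c ∈ t, p c) * ∏ c ∈ tᶜ, (1 - p c)) * (G₁ t.toLeft * G₂ t.toRight) =
      (∑ t₁ : Finset C₁, ((∏ c ∈ t₁, p (Sum.inl c)) * ∏ c ∈ t₁ᶜ, (1 - p (Sum.inl c))) * G₁ t₁) *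
        ∑ t₂ : Finset C₂, ((∏ c ∈ t₂, p (Sum.inr c)) * ∏ c ∈ t₂ᶜ, (1 - p (Sum.inr c))) * G₂ t₂ := by
  rw [Finset.sum_mul_sum, ← Fintype.sum_prod_type']
  refine Fintype.sum_equiv Finset.sumEquiv.toEquiv _ _ fun t => ?_
  simp only [RelIso.coe_fn_toEquiv, Finset.sumEquiv_apply_fst, Finset.sumEquiv_apply_snd]
  rw [bw_sum_split]
  ring

/-! ## Pattern families as configurations of port coordinates -/

/-- Port coordinates: (copy, `V⁺`-port ⊕ `V⁻`-port). -/
abbrev PortCoord (nv P : ℕ) : Type := (Fin nv × ZMod 2) × (Fin P ⊕ Fin P)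

/-- The family of port patterns of a configuration of port coordinates. -/
def patOf (t : Finset (PortCoord nv P)) : Fin nv × ZMod 2 → Finset (Fin P) × Finset (Fin P) :=
  fun g => (univ.filter fun i => (g, Sum.inl i) ∈ t, univ.filter fun i => (g, Sum.inr i) ∈ t)

/-- Families of port patterns are the same as configurations of port coordinates. -/
def patEquiv (nv P : ℕ) : Finset (PortCoord nv P) ≃ (Fin nv × ZMod 2 → Finset (Fin P) × Finset (Fin P)) where
  toFun := patOf
  invFun Pt := univ.filter fun c => Sum.elim (fun i => i ∈ (Pt c.1).1) (fun i => i ∈ (Pt c.1).2) c.2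
  left_inv t := by
    apply Finset.ext
    rintro ⟨g, i | i⟩ <;> simp [patOf]
  right_inv Pt := by
    funext g
    refine Prod.ext ?_ ?_ <;> apply Finset.ext <;> intro i <;> simp [patOf]

/-- Reindexing sums over families of port patterns by configurations of port coordinates. -/
theorem sum_patEquiv {β : Type*} [AddCommMonoid β] (F : (Fin nv × ZMod 2 → Finset (Fin P) × Finset (Fin P)) → β) :
    ∑ Pt, F Pt = ∑ t : Finset (PortCoord nv P), F (patOf t) :=
  (Fintype.sum_equiv (patEquiv nv P) _ _ fun _ => rfl).symm

/-- The occupation probability of a port coordinate: `a g` on the `V⁺`-ports and `c g` on the `V⁻`-ports of copy `g`. -/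
def portProb (a c : Fin nv × ZMod 2 → ℝ) : PortCoord nv P → ℝ :=
  fun x => Sum.elim (fun _ => a x.1) (fun _ => c x.1) x.2

/-- **The product of the port laws is the Bernoulli product weight** of the configuration of port coordinates. -/
theorem prod_portLaw_patOf (a c : Fin nv × ZMod 2 → ℝ) (t : Finset (PortCoord nv P)) :
    ∏ g, portLaw (a g) (c g) P (patOf t g) = (∏ x ∈ t, portProb a c x) * ∏ x ∈ tᶜ, (1 - portProb a c x) := by
  rw [bw_eq_prod_fib (portProb a c) t]
  refine Finset.prod_congr rfl fun g _ => ?_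
  rw [bw_sum_split]
  have hL : (univ.filter fun l : Fin P ⊕ Fin P => (g, l) ∈ t).toLeft = (patOf t g).1 := by
    apply Finset.ext; intro i; simp [patOf]
  have hR : (univ.filter fun l : Fin P ⊕ Fin P => (g, l) ∈ t).toRight = (patOf t g).2 := by
    apply Finset.ext; intro i; simp [patOf]
  rw [hL, hR]
  simp only [portProb, Sum.elim_inl, Sum.elim_inr, prod_const, card_compl, Fintype.card_fin]
  rfl

/-! ## The coordinates read by the wiring -/

/-- Pair coordinates: (variable, (copy, pair slot) on the `V⁺` side ⊕ the same on the `V⁻` side). -/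
abbrev PairCoord (nv κ₁ : ℕ) : Type := Fin nv × ((ZMod 2 × Fin κ₁) ⊕ (ZMod 2 × Fin κ₁))

/-- End coordinates: (complex, end). -/
abbrev EndCoord (m K : ℕ) : Type := (Fin m × Fin K) × (Fin 3 × ZMod 2)

/-- The port coordinate read by a pair/end coordinate. -/
def coordMap (E : Fin m → Fin 3 → Fin nv) (loc : Fin m × Fin 3 → Fin D) (W : LWiring v P κ₁ D K) :
    PairCoord nv κ₁ ⊕ EndCoord m K → PortCoord nv P
  | .inl (x, .inl (a, j)) => ((x, a), .inl (W.slot (.inl j)))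
  | .inl (x, .inr (a, j)) => ((x, a), .inr (W.slot (.inl j)))
  | .inr (c, (i, a)) => ((E c.1 i, a), .inl (W.slot (.inr (loc (c.1, i), c.2))))

/-- **Distinct wiring coordinates read distinct ports** (slots are injective; the occurrence colouring is injective
on the occurrences of a variable). -/
theorem coordMap_injective (E : Fin m → Fin 3 → Fin nv) (loc : Fin m × Fin 3 → Fin D)
    (hloc : ∀ p p' : Fin m × Fin 3, E p.1 p.2 = E p'.1 p'.2 → loc p = loc p' → p = p') (W : LWiring v P κ₁ D K) :
    Function.Injective (coordMap E loc W) := by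
  rintro (⟨x, ⟨a, j⟩ | ⟨a, j⟩⟩ | ⟨c, i, a⟩) (⟨x', ⟨a', j'⟩ | ⟨a', j'⟩⟩ | ⟨c', i', a'⟩) h <;>
    simp only [coordMap, Prod.mk.injEq, Sum.inl.injEq, Sum.inr.injEq, reduceCtorEq, and_false] at h ⊢
  · obtain ⟨⟨rfl, rfl⟩, h2⟩ := h
    have := W.slot.injective h2
    simp only [Sum.inl.injEq] at this
    subst this
    exact ⟨rfl, rfl, rfl⟩
  · obtain ⟨-, h2⟩ := h
    exact absurd (W.slot.injective h2) (by simp)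
  · obtain ⟨⟨rfl, rfl⟩, h2⟩ := h
    have := W.slot.injective h2
    simp only [Sum.inl.injEq] at this
    subst this
    exact ⟨rfl, rfl, rfl⟩
  · obtain ⟨-, h2⟩ := h
    exact absurd (W.slot.injective h2) (by simp)
  · obtain ⟨⟨h1, rfl⟩, h2⟩ := h
    have h3 := W.slot.injective h2
    simp only [Sum.inr.injEq, Prod.mk.injEq] at h3
    obtain ⟨h4, h5⟩ := h3
    have h6 := hloc (c.1, i) (c'.1, i') h1 h4
    simp only [Prod.mk.injEq] at h6
    obtain ⟨h7, rfl⟩ := h6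
    exact ⟨Prod.ext h7 h5, rfl, rfl⟩

/-- The weight of a family of port patterns as an integrand on the wiring coordinates: the pair indicator times the
complex factors at the `{0,1}`-valued vacancies of the end coordinates. -/
def wtOfCoords (nv κ₁ : ℕ) (b : Fin m → ZMod 2) (lam : ℝ)
    (τ : Finset (PairCoord nv κ₁ ⊕ EndCoord m K)) : ℝ :=
  (if ∀ (x : Fin nv) (j : Fin κ₁),
        ¬ ((Sum.inl (x, Sum.inl (0, j)) : PairCoord nv κ₁ ⊕ EndCoord m K) ∈ τ ∧
            (Sum.inl (x, Sum.inl (1, j)) : PairCoord nv κ₁ ⊕ EndCoord m K) ∈ τ) ∧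
          ¬ ((Sum.inl (x, Sum.inr (0, j)) : PairCoord nv κ₁ ⊕ EndCoord m K) ∈ τ ∧
              (Sum.inl (x, Sum.inr (1, j)) : PairCoord nv κ₁ ⊕ EndCoord m K) ∈ τ)
      then 1 else 0) *
    ∏ c : Fin m × Fin K, cxWeight (b c.1) lam
      (fun q => if (Sum.inr (c, q) : PairCoord nv κ₁ ⊕ EndCoord m K) ∉ τ then 1 else 0)

/-- **The pattern weight reads only the wiring coordinates.** -/
theorem lgWt_patOf (E : Fin m → Fin 3 → Fin nv) (loc : Fin m × Fin 3 → Fin D) (W : LWiring v P κ₁ D K)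
    (b : Fin m → ZMod 2) (lam : ℝ) (t : Finset (PortCoord nv P)) :
    lgWt E loc W b lam (patOf t) = wtOfCoords nv κ₁ b lam (univ.filter fun u => coordMap E loc W u ∈ t) := by
  unfold lgWt wtOfCoords
  rw [sum_cxOK_eq_prod]
  congr 1
  · refine ite_congr_prop ?_ 1 0
    simp only [PairOK, patOf, coordMap, mem_filter, mem_univ, true_and]
  · refine Finset.prod_congr rfl fun c _ => congrArg (cxWeight (b c.1) lam) (funext fun q => ?_)
    refine ite_congr_prop ?_ 1 0
    simp only [patOf, coordMap, mem_filter, mem_univ, true_and]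

/-! ## The pair factor -/

/-- **The pair factor**: under independent occupation of the `2κ₁ + 2κ₁` pair ports of the two literal gadgets of a
variable, the probability that no pair edge is doubly occupied is `pairW`. -/
theorem sum_bw_pairIndicator {qp qm : ℝ} (s₀ s₁ : Bool) :
    ∑ s : Finset ((ZMod 2 × Fin κ₁) ⊕ (ZMod 2 × Fin κ₁)),
      ((∏ c ∈ s, Sum.elim (fun y : ZMod 2 × Fin κ₁ => occP qp qm (if y.1 = 0 then s₀ else s₁))
            (fun y : ZMod 2 × Fin κ₁ => occM qp qm (if y.1 = 0 then s₀ else s₁)) c) *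
          ∏ c ∈ sᶜ, (1 - Sum.elim (fun y : ZMod 2 × Fin κ₁ => occP qp qm (if y.1 = 0 then s₀ else s₁))
            (fun y : ZMod 2 × Fin κ₁ => occM qp qm (if y.1 = 0 then s₀ else s₁)) c)) *
        (if ∀ j : Fin κ₁, ¬ ((Sum.inl (0, j) : (ZMod 2 × Fin κ₁) ⊕ (ZMod 2 × Fin κ₁)) ∈ s ∧
                (Sum.inl (1, j) : (ZMod 2 × Fin κ₁) ⊕ (ZMod 2 × Fin κ₁)) ∈ s) ∧
              ¬ ((Sum.inr (0, j) : (ZMod 2 × Fin κ₁) ⊕ (ZMod 2 × Fin κ₁)) ∈ s ∧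
                (Sum.inr (1, j) : (ZMod 2 × Fin κ₁) ⊕ (ZMod 2 × Fin κ₁)) ∈ s)
          then 1 else 0) = pairW qp qm κ₁ s₀ s₁ := by
  have h10 : (1 : ZMod 2) ≠ 0 := by decide
  -- the pairs, indexed by `Fin κ₁ ⊕ Fin κ₁`
  let u : Fin κ₁ ⊕ Fin κ₁ → (ZMod 2 × Fin κ₁) ⊕ (ZMod 2 × Fin κ₁) := Sum.map (fun j => (0, j)) (fun j => (0, j))
  let w : Fin κ₁ ⊕ Fin κ₁ → (ZMod 2 × Fin κ₁) ⊕ (ZMod 2 × Fin κ₁) := Sum.map (fun j => (1, j)) (fun j => (1, j))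
  have key := SlyReduction.sum_bernoulliWeight_noPair
    (Sum.elim (fun y : ZMod 2 × Fin κ₁ => occP qp qm (if y.1 = 0 then s₀ else s₁))
      (fun y : ZMod 2 × Fin κ₁ => occM qp qm (if y.1 = 0 then s₀ else s₁)))
    (Finset.univ : Finset (Fin κ₁ ⊕ Fin κ₁)) u w
    (by rintro (j | j) - (j' | j') - h <;> simp [u] at h ⊢ <;> exact h)
    (by rintro (j | j) - (j' | j') - h <;> simp [w] at h ⊢ <;> exact h)
    (by rintro (j | j) - (j' | j') - h <;> simp [u, w, h10.symm] at h)
  rw [Fintype.prod_sum_type] at key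
  simp only [u, w, Sum.map_inl, Sum.map_inr, Sum.elim_inl, Sum.elim_inr, if_true, if_neg h10, prod_const,
    card_univ, Fintype.card_fin] at key
  rw [pairW, mul_pow, ← key]
  refine Finset.sum_congr rfl fun s _ => congrArg _ (ite_congr_prop ?_ 1 0)
  simp only [mem_univ, true_implies, Sum.forall, Sum.map_inl, Sum.map_inr]
  exact ⟨fun h => ⟨fun j => (h j).1, fun j => (h j).2⟩, fun h j => ⟨h.1 j, h.2 j⟩⟩

/-! ## The complex factor -/

/-- **Multilinearity of the complex factor**: under independent occupation of its six ports, the expectation of the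
complex factor at the `{0,1}`-valued vacancies is the complex factor at the mean vacancies `1 - p`. -/
theorem sum_bw_cxWeight (e : ZMod 2) (lam : ℝ) (p : Fin 3 × ZMod 2 → ℝ) :
    ∑ s : Finset (Fin 3 × ZMod 2), ((∏ q ∈ s, p q) * ∏ q ∈ sᶜ, (1 - p q)) *
        cxWeight e lam (fun q => if q ∉ s then 1 else 0) = cxWeight e lam (fun q => 1 - p q) := by
  unfold cxWeight
  simp_rw [Finset.mul_sum]
  rw [Finset.sum_comm]
  refine Finset.sum_congr rfl fun J _ => ?_
  by_cases hJ : (cxGraph e).IsIndepSet (↑J : Set CxVert)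
  · simp_rw [if_pos hJ]
    -- the product of the indicators is the indicator of disjointness from the occupied ends
    have hind : ∀ s : Finset (Fin 3 × ZMod 2),
        (∏ q : Fin 3 × ZMod 2, (if (Sum.inl q : CxVert) ∈ J then (if q ∉ s then (1 : ℝ) else 0) else 1)) =
          if Disjoint (univ.filter fun q : Fin 3 × ZMod 2 => (Sum.inl q : CxVert) ∈ J) s then 1 else 0 := by
      intro s
      by_cases hd : Disjoint (univ.filter fun q : Fin 3 × ZMod 2 => (Sum.inl q : CxVert) ∈ J) s
      · rw [if_pos hd]
        refine Finset.prod_eq_one fun q _ => ?_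
        by_cases hq : (Sum.inl q : CxVert) ∈ J
        · rw [if_pos hq, if_pos]
          exact Finset.disjoint_left.1 hd (by simp [hq])
        · rw [if_neg hq]
      · rw [if_neg hd]
        obtain ⟨q, hq1, hq2⟩ := Finset.not_disjoint_iff.1 hd
        refine Finset.prod_eq_zero (Finset.mem_univ q) ?_
        rw [if_pos (by simpa using hq1), if_neg (not_not.2 hq2)]
    have hrw : ∀ s : Finset (Fin 3 × ZMod 2),
        ((∏ q ∈ s, p q) * ∏ q ∈ sᶜ, (1 - p q)) *
            (lam ^ J.card * ∏ q : Fin 3 × ZMod 2, (if (Sum.inl q : CxVert) ∈ J then (if q ∉ s then (1 : ℝ) else 0) else 1)) =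
          lam ^ J.card * (((∏ q ∈ s, p q) * ∏ q ∈ sᶜ, (1 - p q)) *
            (if Disjoint (univ.filter fun q : Fin 3 × ZMod 2 => (Sum.inl q : CxVert) ∈ J) s then 1 else 0)) := by
      intro s; rw [hind s]; ring
    simp_rw [hrw]
    rw [← Finset.mul_sum, sum_bw_disjoint, Finset.prod_filter]
  · simp_rw [if_neg hJ]
    simp

/-- The complex factors of one equation, collected over its `K` complexes and normalised:
`Π_{(e,j)} F_{b e} = Π_e (cxW_e · (1+λ)^{10})^K`. -/
theorem prod_cxWeight_eq (E : Fin m → Fin 3 → Fin nv) (b : Fin m → ZMod 2) {lam : ℝ} (hlam : 0 ≤ lam) (qp qm : ℝ)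
    (Y : Fin nv × ZMod 2 → Bool) :
    ∏ c : Fin m × Fin K, cxWeight (b c.1) lam (fun q => 1 - occP qp qm (Y (E c.1 q.1, q.2))) =
      (∏ e : Fin m, cxW lam qp qm (b e) (fun q => Y (E e q.1, q.2)) ^ K) * (1 + lam) ^ (10 * m * K) := by
  have h10 : (1 + lam) ^ 10 ≠ 0 := pow_ne_zero _ (by linarith)
  have hcx : ∀ e : Fin m, cxWeight (b e) lam (fun q => 1 - occP qp qm (Y (E e q.1, q.2))) =
      cxW lam qp qm (b e) (fun q => Y (E e q.1, q.2)) * (1 + lam) ^ 10 := fun e => by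
    rw [cxW, div_mul_cancel₀ _ h10]
  rw [Fintype.prod_prod_type]
  dsimp only
  simp only [prod_const, card_univ, Fintype.card_fin]
  simp_rw [hcx, mul_pow]
  rw [prod_mul_distrib, prod_const, card_univ, Fintype.card_fin, ← pow_mul, ← pow_mul, Nat.mul_assoc 10 m K,
    Nat.mul_comm m K]

/-! ## The expectation -/

/-- **The product-measure expectation of the pattern weight**:
`Σ_P (Π_g Q^{Y_g}(P_g)) · lgWt(P) = lgW b Y · (1+λ)^{10mK}`. -/
theorem expect_lgWt (E : Fin m → Fin 3 → Fin nv) (loc : Fin m × Fin 3 → Fin D)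
    (hloc : ∀ p p' : Fin m × Fin 3, E p.1 p.2 = E p'.1 p'.2 → loc p = loc p' → p = p') (W : LWiring v P κ₁ D K)
    (b : Fin m → ZMod 2) {lam : ℝ} (hlam : 0 ≤ lam) (qp qm : ℝ) (Y : Fin nv × ZMod 2 → Bool) :
    ∑ Pt : Fin nv × ZMod 2 → Finset (Fin P) × Finset (Fin P),
        (∏ g, portLaw (occP qp qm (Y g)) (occM qp qm (Y g)) P (Pt g)) * lgWt E loc W b lam Pt =
      lgW E lam qp qm κ₁ K b Y * (1 + lam) ^ (10 * m * K) := by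
  -- to configurations of port coordinates, then to the wiring coordinates
  rw [sum_patEquiv]
  simp_rw [prod_portLaw_patOf, lgWt_patOf]
  rw [sum_bw_marginal (coordMap E loc W) (coordMap_injective E loc hloc W)
    (portProb (fun g => occP qp qm (Y g)) (fun g => occM qp qm (Y g))) (wtOfCoords nv κ₁ b lam)]
  -- the integrand splits over pair and end coordinates
  let G₁ : Finset (PairCoord nv κ₁) → ℝ := fun t₁ =>
    if ∀ (x : Fin nv) (j : Fin κ₁),
        ¬ ((x, Sum.inl (0, j)) ∈ t₁ ∧ (x, Sum.inl (1, j)) ∈ t₁) ∧ ¬ ((x, Sum.inr (0, j)) ∈ t₁ ∧ (x, Sum.inr (1, j)) ∈ t₁)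
      then (1 : ℝ) else 0
  let G₂ : Finset (EndCoord m K) → ℝ := fun t₂ =>
    ∏ c : Fin m × Fin K, cxWeight (b c.1) lam (fun q => if (c, q) ∉ t₂ then 1 else 0)
  have hsplit : ∀ τ : Finset (PairCoord nv κ₁ ⊕ EndCoord m K), wtOfCoords nv κ₁ b lam τ = G₁ τ.toLeft * G₂ τ.toRight := by
    intro τ
    unfold wtOfCoords
    congr 1
    · exact ite_congr_prop (by simp only [mem_toLeft]) 1 0
    · exact Finset.prod_congr rfl fun c _ =>
        congrArg (cxWeight (b c.1) lam) (funext fun q => ite_congr_prop (by simp only [mem_toRight]) 1 0)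
  simp_rw [hsplit]
  rw [sum_bw_sum_mul _ G₁ G₂, lgW, mul_assoc]
  congr 1
  · -- the pair block: a product over the variables of `pairW`
    let A₁ : Fin nv → Finset ((ZMod 2 × Fin κ₁) ⊕ (ZMod 2 × Fin κ₁)) → ℝ := fun x s =>
      if ∀ j : Fin κ₁,
          ¬ ((Sum.inl (0, j) : (ZMod 2 × Fin κ₁) ⊕ (ZMod 2 × Fin κ₁)) ∈ s ∧
              (Sum.inl (1, j) : (ZMod 2 × Fin κ₁) ⊕ (ZMod 2 × Fin κ₁)) ∈ s) ∧
            ¬ ((Sum.inr (0, j) : (ZMod 2 × Fin κ₁) ⊕ (ZMod 2 × Fin κ₁)) ∈ s ∧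
              (Sum.inr (1, j) : (ZMod 2 × Fin κ₁) ⊕ (ZMod 2 × Fin κ₁)) ∈ s)
        then (1 : ℝ) else 0
    have hind : ∀ t₁ : Finset (PairCoord nv κ₁), G₁ t₁ = ∏ x : Fin nv, A₁ x (univ.filter fun l => (x, l) ∈ t₁) := by
      intro t₁
      symm
      by_cases h : ∀ (x : Fin nv) (j : Fin κ₁),
          ¬ ((x, Sum.inl (0, j)) ∈ t₁ ∧ (x, Sum.inl (1, j)) ∈ t₁) ∧ ¬ ((x, Sum.inr (0, j)) ∈ t₁ ∧ (x, Sum.inr (1, j)) ∈ t₁)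
      · rw [show G₁ t₁ = 1 from if_pos h]
        refine Finset.prod_eq_one fun x _ => ?_
        exact if_pos fun j => by simpa only [mem_filter, mem_univ, true_and] using h x j
      · rw [show G₁ t₁ = 0 from if_neg h]
        obtain ⟨x, hx⟩ := not_forall.1 h
        refine Finset.prod_eq_zero (Finset.mem_univ x) ?_
        exact if_neg fun h' => hx fun j => by simpa only [mem_filter, mem_univ, true_and] using h' j
    simp_rw [hind]
    rw [sum_bw_prod_split _ A₁]
    refine Finset.prod_congr rfl fun x _ => ?_
    have hprob : ∀ l : (ZMod 2 × Fin κ₁) ⊕ (ZMod 2 × Fin κ₁),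
        portProb (P := P) (fun g => occP qp qm (Y g)) (fun g => occM qp qm (Y g)) (coordMap E loc W (Sum.inl (x, l))) =
          Sum.elim (fun y : ZMod 2 × Fin κ₁ => occP qp qm (if y.1 = 0 then Y (x, 0) else Y (x, 1)))
            (fun y : ZMod 2 × Fin κ₁ => occM qp qm (if y.1 = 0 then Y (x, 0) else Y (x, 1))) l := by
      have h01 : ∀ a : ZMod 2, a = 0 ∨ a = 1 := by decide
      rintro (⟨a, j⟩ | ⟨a, j⟩) <;> rcases h01 a with rfl | rfl <;> simp [portProb, coordMap]
    simp_rw [hprob]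
    exact sum_bw_pairIndicator (Y (x, 0)) (Y (x, 1))
  · -- the end block: a product over the complexes of the complex factors at the mean vacancies
    let A₂ : (Fin m × Fin K) → Finset (Fin 3 × ZMod 2) → ℝ := fun c s =>
      cxWeight (b c.1) lam (fun q => if q ∉ s then 1 else 0)
    have hfib : ∀ t₂ : Finset (EndCoord m K), G₂ t₂ = ∏ c : Fin m × Fin K, A₂ c (univ.filter fun l => (c, l) ∈ t₂) := by
      intro t₂
      exact Finset.prod_congr rfl fun c _ => congrArg (cxWeight (b c.1) lam) (funext fun q =>
        ite_congr_prop (by simp only [mem_filter, mem_univ, true_and]) 1 0)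
    simp_rw [hfib]
    rw [sum_bw_prod_split _ A₂]
    have hprob : ∀ (c : Fin m × Fin K) (q : Fin 3 × ZMod 2),
        portProb (P := P) (fun g => occP qp qm (Y g)) (fun g => occM qp qm (Y g)) (coordMap E loc W (Sum.inr (c, q))) =
          occP qp qm (Y (E c.1 q.1, q.2)) := fun c q => by simp [portProb, coordMap]
    simp_rw [hprob]
    rw [Finset.prod_congr rfl fun c _ => sum_bw_cxWeight (b c.1) lam (fun q => occP qp qm (Y (E c.1 q.1, q.2)))]
    exact prod_cxWeight_eq E b hlam qp qm Y

end Summit.PneNP.PneNP.Cruxes.MacroscopicTwinsAbove.LiteralGadgetsCfiApparatus
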